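import Literature.NumberTheory.GaloisRepresentations.LubinTateColemanUnitsImageSpecializationTwo
import Literature.NumberTheory.GaloisRepresentations.LubinTateColemanUnitsImageTraceNormTwo
import Literature.NumberTheory.GaloisRepresentations.LubinTateColemanCoordBaseChangeTwo
import HarnessLib

/-!
# The specialisation `X ↦ ζ − 1` of the `ℤ/d`-trace of the two-variable Coleman transform at a CHARACTER `χ` of the unramified
# direction (`χ(φ_m) = ζ`, `ζ^{p^m} = 1`, `q = 2`): its level-`m` reading is the `χ`-RESOLVENT
# `(Σ_σ χ(σ⁻¹)σθ_m)⁻¹ · Σ_{σ ∈ Gal(E_m/F)} χ(σ⁻¹)(r_{β,m})^σ`, so its `k`-th moment is the `χ`-resolvent of the Coates–Wiles moments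

De Shalit, *Iwasawa theory of elliptic curves with complex multiplication* (1987), Ch. I §3.1 (`ℤ_p⟦𝒢⟧ = Λ[Δ]`, a group element is
`χ(σ)(1+X)^{α(σ)}` on the `χ`-parts), §3.5 (11), §3.7–§3.8 (16)–(17) (the two-variable algebra `Λ(𝒢; 𝒪) = 𝒪⟦X⟧⟦T⟧`, `1 + X ↔ φ`; a character
`χ` of finite order of the unramified direction `Gal(E_∞/F) ≅ ℤ_p` is the specialisation `X ↦ χ(φ) − 1 = ζ − 1`), Ch. II §4.12 (29)–(31), Ch. III
§1.3.  `LubinTateColemanUnitsImageSpecializationTwo` read the `ℤ/d`-trace `Σ_j Col β (j)` at the TRIVIAL character `X ↦ 0` (`ζ = 1`):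
`C(Σ_σ σθ_m)·ι_m[X⁰]Σ_j G_j = Σ_σ (r_{β,m})^σ` and `(Σ_σ σθ_m)·mom_k(…) = Σ_σ σ(mom_k(r_{β,m}))`.  THIS file is its twin at an ARBITRARY
character `χ : Gal(E_m/F) → S` with `χ(φ_m) = ζ`, `ζ^{p^m} = 1`, read through ring data POSITED as an interface — a commutative ring `S`, a
ring map `κ : 𝒪_F⟦X⟧ → S` with `κ(X) = ζ − 1` (so `κ((1+X)^i) = ζ^i` and `κ(ω_m) = 0`), and a coefficient map `ψ : 𝒪_{E_m} → S` with
`κ ∘ C = ψ ∘ ι` — never constructed here (the construction `S = 𝒪_{E_m(ζ)}` is a separate statement).  Everything PROVED (0 sorry, no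
definitions, no instances, no named facts):

* §1 (the ring data, any `S`) ★ `colemanDeltaCoinvFun_map_eq_of_eq_twist_mul` — READING the (c)-capstone relation `φ_ε(x) = (t_v·C g − C n)·L`
  in `Λ = 𝒪_F⟦X⟧⟦T⟧` along `κ`: **`φ^S_{κε}(κ x) = (t_v^S·C(κ g) − C n)·κ L`** in `S⟦T⟧` (`colemanDeltaCoinvFun_map` +
  `colemanDeltaCoinvFun_unitTwistₗ_one_map`; at a non-trivial `χ` the Amice element contributes `κ g = g(ζ − 1) = χ(σ_𝔟|E_m)`, de Shalit's
  `ε(σ_𝔞)` in II §4.12 (31)).  Character orthogonality `Σ_σ χ(σ) = 0` (`χ ≠ 1`, `S` a domain) is Mathlib's `sum_hom_units_eq_zero` — cited,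
  not restated.
* §2 ★ `map_sum_amiceSum_eq_sum_character` — **`κ(Σ_j Φ_m(y)(j)) = Σ_{σ ∈ Gal(E_m/F)} χ(σ)·κ(C a_y(σ))`** (`(1+X)^i ↦ ζ^i = χ(φ^i)`, CRT
  `χ_m⁻¹(j,i) ≡ i (p^m)`, `n ↦ φ^n` a bijection `ℤ/dp^m → Gal(E_m/F)`); `map_sum_eq_sum_character_of_isAmiceLevel` (`κ(ω_m) = 0`).
* §3 ★ `sum_character_mul_map_unitBallEquiv_eq` — the `χ`-RESOLVENT of `y = Σ_ρ a_y(ρ)ρθ` in a normal integral basis: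
  **`Σ_σ χ(σ⁻¹)ψ(σy) = (Σ_ρ χ(ρ)ψ(a_y(ρ))) · Σ_σ χ(σ⁻¹)ψ(σθ)`**.
* §4 ★★ `C_sum_character_mul_map_sum_colemanImage_eq` — for `G = Col β`, in `S⟦Y⟧`:
  **`C(Σ_σ χ(σ⁻¹)ψ(σθ_m)) · κ(Σ_j G_j) = Σ_σ C(χ(σ⁻¹)) · (ψσ)(r_{β,m})`** (coefficientwise: `IsTransformProd` + §2 + §3).
* §5 (`S = 𝒪_{E'}`, `E_m ≤ E'` a finite subextension of `F̄` containing `ζ`, `ψ = ι_{E'/E_m}`) ★★★ **`sum_character_mul_coordMoment_specialization`** —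
  **`(Σ_σ χ(σ⁻¹)σθ_m) · mom_k(κ(Σ_j G_j)) = Σ_σ χ(σ⁻¹) · σ(mom_k(r_{β,m}))`** in `𝒪_{E'}` (`mom_k` commutes with `ι_{E'/E_m} ∘ σ`,
  `coordMoment_map_of_forall_eq`): the moments of the `χ`-specialised trace are the `χ`-resolvents of the Coates–Wiles moments of the
  level-`m` coordinates.  At `χ = 1`, `E' = E_m`, `κ = ι_m ∘ [X⁰]` this is `sum_unitBallEquiv_mul_coordMoment_specialization` VERBATIM
  (the closing `example`).

Scope (honest): `χ` ranges over the characters of `Gal(E_m/F) ≅ ℤ/d × ℤ/p^m` with `χ(φ_m)^{p^m} = 1`, i.e. trivial on the prime-to-`p`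
part `ℤ/d` — the characters seen by `Λ = 𝒪_F⟦X⟧⟦T⟧` through the index trace `Σ_j`; the `ℤ/d`-part is carried by the index `j` itself.
Cell `bsd-print-cf2`, width seat `bsd-line-cf2c-w7` g32 (memo v13.1 (M2)(i)′, wish-list (W1)–(W2)).

## References
* E. de Shalit, *Iwasawa theory of elliptic curves with complex multiplication* (1987), Ch. I §3.1, §3.5 (11), §3.7, §3.8 (16)–(17); Ch. II
  §4.12 (29)–(31); Ch. III §1.3, §1.8. [deShalit1987]
* J.-P. Serre, *Local Fields* (1979), Ch. I §4 Prop. 10, Ch. II §2. [SerreLocalFields1979]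
* L. C. Washington, *Introduction to Cyclotomic Fields*, 2nd ed. (1997), §7.1, §13.2. [Washington1997]
-/

noncomputable section

namespace Literature.NumberTheory.GaloisRepresentations

section UnitsImageSpecializationCharacterTwo

open GaloisRepresentations.IsNonarchimedeanLocalField LubinTate ValuativeRel Field Finset

variable {F : Type} [Field F] [ValuativeRel F] [TopologicalSpace F] [IsNonarchimedeanLocalField F]

attribute [local instance] ltNormUniformSpace ltNormIsUniformAddGroup rk1 nF nE fintypeResidueField

variable {p : ℕ} [hp : Fact p.Prime] {d : ℕ} [NeZero d] (hd : d.Coprime p)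
variable {π : 𝒪[F]} (hπ : (valuation F).IsUniformizer (π : F))
variable (E : ℕ → IntermediateField F (AlgebraicClosure F)) [∀ m, FiniteDimensional F (E m)] [∀ m, Normal F (E m)] [∀ m, IsGalois F (E m)]
  (hmono : Monotone E) (hE : ∀ m, E m ≤ maxUnramified F) (hdeg : ∀ m, Module.finrank F (E m) = d * p ^ m)
  {σ₀ : absoluteGaloisGroup F} (hσ₀ : IsAbsArithFrob σ₀) (hq : residueFieldCard F = 2)
variable (u : (LTCoeff F)ˣ) (hu : LTCoeff.of F π = residueFieldCard F * u) (γ : 𝒪[F]ˣ)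
variable {S : Type*} [CommRing S]

/-! ### §1. The ring data `(S, ι', κ)` of a specialisation of the unramified variable, and the capstone relation read along `κ` -/

section RingData

variable (ι' : LTCoeff F →+* S) (κ : PowerSeries 𝒪[F] →+* S) (hκ : κ.comp (intBase F) = ι')
variable [IsAdicComplete (Ideal.span {intBase F (LTCoeff.of F π)}) (PowerSeries 𝒪[F])] [IsAdicComplete (Ideal.span {ι' (LTCoeff.of F π)}) S]
variable (hreg' : ∀ s : S, ι' (LTCoeff.of F π) * s = 0 → s = 0) (w : 𝒪[F]ˣ) (hγ : (γ : 𝒪[F]) = 1 + π ^ 2 * w)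
  (ε : PowerSeries (PowerSeries 𝒪[F]))

include hκ in
/-- ★ **The (c)-capstone relation read along a specialisation `κ : 𝒪_F⟦X⟧ → S` of the unramified variable**: if
`φ_ε(x) = (t_v·C g − C n)·L` in `Λ = 𝒪_F⟦X⟧⟦T⟧` (`t_v = φ_ε(σ_v 1)`), then over `S` (module `S⟦Y⟧`, projection `φ^S_{κε}`)
**`φ^S_{κε}(κ x) = (t_v^S·C(κ g) − C n)·κ L`** — the twist scalars are base-change invariant and `φ_ε` commutes with `map κ`.  At the trivial
character (`κ = ι ∘ [X⁰]`, `g(0) = 1`) the factor `C(κ g)` is `1`; at `X ↦ ζ − 1` it is `g(ζ − 1)`, the value of the unramified character.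
[cite: deShalit1987, Ch. I §3.7, §3.8 (17); Ch. II §4.12 (29)–(31); Ch. III §1.8] -/
theorem colemanDeltaCoinvFun_map_eq_of_eq_twist_mul (x : ColemanCoordModule hπ hq (intBase F) u hu γ) (v : 𝒪[F]ˣ) (g : PowerSeries 𝒪[F])
    (n : ℕ) (L : PowerSeries (PowerSeries 𝒪[F]))
    (hL : colemanDeltaCoinvFun hπ hq (intBase F) u hu γ (eq_zero_of_C_pi_mul_eq_zero_integer hπ) w hγ ε x =
      (colemanDeltaCoinvFun hπ hq (intBase F) u hu γ (eq_zero_of_C_pi_mul_eq_zero_integer hπ) w hγ ε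
          (unitTwistₗ hπ hq (intBase F) u hu γ v (TActModule.ofPS _ _ 1)) * PowerSeries.C g - PowerSeries.C ((n : ℕ) : PowerSeries 𝒪[F])) * L) :
    colemanDeltaCoinvFun hπ hq ι' u hu γ hreg' w hγ (PowerSeries.map κ ε)
        (TActModule.ofPS _ _ (PowerSeries.map κ (TActModule.toPS x)) : ColemanCoordModule hπ hq ι' u hu γ) =
      (colemanDeltaCoinvFun hπ hq ι' u hu γ hreg' w hγ (PowerSeries.map κ ε) (unitTwistₗ hπ hq ι' u hu γ v (TActModule.ofPS _ _ 1)) *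
          PowerSeries.C (κ g) - PowerSeries.C (n : S)) * PowerSeries.map κ L := by
  have hbc := colemanDeltaCoinvFun_map hπ hq (intBase F) ι' κ hκ u hu γ (eq_zero_of_C_pi_mul_eq_zero_integer hπ) hreg' w hγ ε x
  have htw := colemanDeltaCoinvFun_unitTwistₗ_one_map hπ hq (intBase F) ι' κ hκ u hu γ (eq_zero_of_C_pi_mul_eq_zero_integer hπ) hreg' w hγ ε v
  have hκn : PowerSeries.map κ (PowerSeries.C ((n : ℕ) : PowerSeries 𝒪[F])) = PowerSeries.C (n : S) := by
    rw [PowerSeries.map_C, map_natCast]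
  rw [hbc, hL, map_mul, map_sub, map_mul, PowerSeries.map_C, hκn, htw]

end RingData

/-! ### §2. The summed Amice polynomials at `X ↦ ζ − 1` -/

omit [NeZero d] in
include hE hdeg hσ₀ in
/-- ★ **`κ(Σ_{j ∈ ℤ/d} Φ_m(y)(j)) = Σ_{σ ∈ Gal(E_m/F)} χ(σ)·κ(C a_y(σ))`** for a ring map `κ : 𝒪_F⟦X⟧ → S` with `κ(X) = ζ − 1`, `ζ^{p^m} = 1`,
and a character `χ : Gal(E_m/F) → S` with `χ(φ_m) = ζ`: `κ((1+X)^i) = ζ^i = ζ^{χ_m⁻¹(j,i)} = χ(φ_m^{χ_m⁻¹(j,i)})` (`χ_m⁻¹(j,i) ≡ i (mod p^m)`),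
the double sum over `(j, i) ∈ ℤ/d × ℤ/p^m` is a sum over `ℤ/dp^m` (CRT), and `n ↦ φ_m^n` is a bijection onto `Gal(E_m/F)`.  At `ζ = 1`, `χ = 1`
this is `constantCoeff_sum_amiceSum`. [cite: deShalit1987, Ch. I §3.1, §3.8 (16)–(17)] -/
theorem map_sum_amiceSum_eq_sum_character [NeZero d] (m : ℕ) {θ : unitBall (E m)} (hθ : IsIntegralNormalGen (E m) θ)
    (κ : PowerSeries 𝒪[F] →+* S) (ζ : S) (hζ : ζ ^ p ^ m = 1) (hκX : κ PowerSeries.X = ζ - 1) (χ : (E m ≃ₐ[F] E m) →* S)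
    (hχ : χ ((absoluteGaloisGroup.toAlgEquiv F σ₀).restrictNormal (E m)) = ζ) (y : unitBall (E m)) :
    κ (∑ j : ZMod d, amiceSum p d hd σ₀ (E := E) hθ y j) = ∑ σ : E m ≃ₐ[F] E m, χ σ * κ (PowerSeries.C (hθ.basis.repr y σ)) := by
  classical
  haveI : NeZero (p ^ m) := ⟨pow_ne_zero m hp.out.ne_zero⟩
  haveI : NeZero (d * p ^ m) := ⟨mul_ne_zero (NeZero.ne d) (NeZero.ne (p ^ m))⟩
  set φ := (absoluteGaloisGroup.toAlgEquiv F σ₀).restrictNormal (E m) with hφ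
  have hκ1 : κ (1 + PowerSeries.X) = ζ := by rw [map_add, map_one, hκX, add_sub_cancel]
  -- `ζ^i = χ(φ^{χ_m⁻¹(j,i)})`
  have hζi : ∀ (j : ZMod d) (i : ZMod (p ^ m)), ζ ^ i.val = χ (φ ^ ((ZMod.chineseRemainder (hd.pow_right m)).symm (j, i)).val) := by
    intro j i
    rw [map_pow χ, hχ, pow_eq_pow_mod ((ZMod.chineseRemainder (hd.pow_right m)).symm (j, i)).val hζ,
      val_chineseRemainder_symm_mod (hd.pow_right m) j i]
  have h1 : κ (∑ j : ZMod d, amiceSum p d hd σ₀ (E := E) hθ y j) =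
      ∑ j : ZMod d, ∑ i : ZMod (p ^ m), χ (φ ^ ((ZMod.chineseRemainder (hd.pow_right m)).symm (j, i)).val) *
        κ (PowerSeries.C (hθ.basis.repr y (φ ^ ((ZMod.chineseRemainder (hd.pow_right m)).symm (j, i)).val))) := by
    rw [map_sum]
    refine sum_congr rfl fun j _ => ?_
    unfold amiceSum
    rw [map_sum]
    refine sum_congr rfl fun i _ => ?_
    rw [map_mul, map_pow κ, hκ1, hζi j i, mul_comm]
  have h2 : (∑ j : ZMod d, ∑ i : ZMod (p ^ m), χ (φ ^ ((ZMod.chineseRemainder (hd.pow_right m)).symm (j, i)).val) *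
        κ (PowerSeries.C (hθ.basis.repr y (φ ^ ((ZMod.chineseRemainder (hd.pow_right m)).symm (j, i)).val)))) =
      ∑ M : ZMod (d * p ^ m), χ (φ ^ M.val) * κ (PowerSeries.C (hθ.basis.repr y (φ ^ M.val))) := by
    rw [← Fintype.sum_prod_type' (f := fun j i => χ (φ ^ ((ZMod.chineseRemainder (hd.pow_right m)).symm (j, i)).val) *
      κ (PowerSeries.C (hθ.basis.repr y (φ ^ ((ZMod.chineseRemainder (hd.pow_right m)).symm (j, i)).val))))]
    exact Fintype.sum_equiv (ZMod.chineseRemainder (hd.pow_right m)).symm.toEquiv _ _ fun q => rfl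
  rw [h1, h2]
  exact Fintype.sum_bijective _ (frobPow_bijective_cyclic p d E hE hdeg hσ₀ m) _ _ fun M => rfl

omit hp [TopologicalSpace F] [IsNonarchimedeanLocalField F] in
/-- **`κ(ω_m) = 0`** for `κ(X) = ζ − 1`, `ζ^{p^m} = 1` (`ω_m = (1+X)^{p^m} − 1`). [cite: deShalit1987, Ch. I §3.8 (17)] -/
theorem map_omega_eq_zero_of_map_X (m : ℕ) (κ : PowerSeries 𝒪[F] →+* S) (ζ : S) (hζ : ζ ^ p ^ m = 1) (hκX : κ PowerSeries.X = ζ - 1) :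
    κ ((1 + PowerSeries.X : PowerSeries 𝒪[F]) ^ p ^ m - 1) = 0 := by
  rw [map_sub, map_pow, map_add, map_one, hκX, add_sub_cancel, hζ, sub_self]

include hE hdeg hσ₀ in
/-- ★ **At `X ↦ ζ − 1` a level-`m` Amice pair reads `κ(Σ_j x j) = Σ_σ χ(σ)·κ(C a_y(σ))`** (`IsAmiceLevel x y`: `x j ≡ Φ_m(y)(j) (mod ω_m)` and
`κ(ω_m) = 0`). [cite: deShalit1987, Ch. I §3.1, §3.8 (17)] -/
theorem map_sum_eq_sum_character_of_isAmiceLevel {m : ℕ} {θ : unitBall (E m)} {hθ : IsIntegralNormalGen (E m) θ}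
    {x : ZMod d → PowerSeries 𝒪[F]} {y : unitBall (E m)} (hx : IsAmiceLevel p d hd σ₀ hθ x y)
    (κ : PowerSeries 𝒪[F] →+* S) (ζ : S) (hζ : ζ ^ p ^ m = 1) (hκX : κ PowerSeries.X = ζ - 1) (χ : (E m ≃ₐ[F] E m) →* S)
    (hχ : χ ((absoluteGaloisGroup.toAlgEquiv F σ₀).restrictNormal (E m)) = ζ) :
    κ (∑ j : ZMod d, x j) = ∑ σ : E m ≃ₐ[F] E m, χ σ * κ (PowerSeries.C (hθ.basis.repr y σ)) := by
  rw [← map_sum_amiceSum_eq_sum_character hd E hE hdeg hσ₀ m hθ κ ζ hζ hκX χ hχ y]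
  have e : ∑ j : ZMod d, x j = ∑ j : ZMod d, amiceSum p d hd σ₀ (E := E) hθ y j + ∑ j : ZMod d, (x j - amiceSum p d hd σ₀ (E := E) hθ y j) := by
    rw [← sum_add_distrib]; exact sum_congr rfl fun j _ => by ring
  rw [e, map_add, add_eq_left, map_sum]
  refine sum_eq_zero fun j _ => ?_
  obtain ⟨c, hc⟩ := hx j
  rw [hc, map_mul, map_omega_eq_zero_of_map_X m κ ζ hζ hκX, zero_mul]

/-! ### §3. The `χ`-resolvent of an element in a normal integral basis -/

/-- ★ **`Σ_σ χ(σ⁻¹)·ψ(σ y) = (Σ_ρ χ(ρ)·ψ(a_y(ρ))) · Σ_σ χ(σ⁻¹)·ψ(σθ)`** for `y = Σ_ρ a_y(ρ)·ρθ` in the normal integral basis generated by `θ`,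
any ring map `ψ : 𝒪_E → S` and any character `χ : Gal(E/F) → S` (reindex `σ ↦ σρ`; `χ((σρ)⁻¹)χ(ρ) = χ(σ⁻¹)`).  At `χ = 1`, `ψ = id`:
`sum_unitBallEquiv_eq_repr_sum_mul`. [cite: SerreLocalFields1979, Ch. I §4 Prop. 10] [cite: deShalit1987, Ch. I §3.1] -/
theorem sum_character_mul_map_unitBallEquiv_eq {E₁ : IntermediateField F (AlgebraicClosure F)} [FiniteDimensional F E₁] [IsGalois F E₁]
    {θ : unitBall E₁} (hθ : IsIntegralNormalGen E₁ θ) (ψ : unitBall E₁ →+* S) (χ : (E₁ ≃ₐ[F] E₁) →* S) (y : unitBall E₁) :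
    ∑ σ : E₁ ≃ₐ[F] E₁, χ σ⁻¹ * ψ (unitBallEquiv E₁ σ y) =
      (∑ ρ : E₁ ≃ₐ[F] E₁, χ ρ * ψ (algebraMap 𝒪[F] (unitBall E₁) (hθ.basis.repr y ρ))) *
        ∑ σ : E₁ ≃ₐ[F] E₁, χ σ⁻¹ * ψ (unitBallEquiv E₁ σ θ) := by
  classical
  have hy : ∀ σ : E₁ ≃ₐ[F] E₁, ψ (unitBallEquiv E₁ σ y) =
      ∑ ρ, ψ (algebraMap 𝒪[F] (unitBall E₁) (hθ.basis.repr y ρ)) * ψ (unitBallEquiv E₁ (σ * ρ) θ) := fun σ => by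
    conv_lhs => rw [← hθ.basis.sum_repr y]
    rw [map_sum, map_sum]
    exact sum_congr rfl fun ρ _ => by rw [unitBallEquiv_smul, hθ.basis_apply, unitBallEquiv_mul_apply, Algebra.smul_def, map_mul]
  simp_rw [hy, mul_sum, sum_mul]
  rw [sum_comm]
  conv_rhs => rw [sum_comm]
  refine sum_congr rfl fun ρ _ => ?_
  refine Fintype.sum_equiv (Equiv.mulRight ρ) _ _ fun σ => ?_
  have hρ : χ ρ * χ ρ⁻¹ = 1 := by rw [← map_mul, mul_inv_cancel, map_one]
  simp only [Equiv.coe_mulRight, mul_inv_rev, map_mul]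
  linear_combination (-(χ σ⁻¹ * ψ (algebraMap 𝒪[F] (unitBall E₁) (hθ.basis.repr y ρ)) * ψ (unitBallEquiv E₁ (σ * ρ) θ))) * hρ

/-! ### §4. The `X ↦ ζ − 1` specialisation of `Σ_j Col β (j)` read at level `m`: the `χ`-resolvent -/

variable [IsAdicComplete (Ideal.span {(p : 𝒪[F])}) 𝒪[F]]
variable {θ : ∀ m, unitBall (E m)} (hθ : ∀ m, IsIntegralNormalGen (E m) (θ m))
  (hcoh : ∀ m, unitBallTrace (hmono (Nat.le_succ m)) (θ (m + 1)) = θ m)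

include hdeg hE hσ₀ in
/-- ★★ **The level-`m` reading of the specialisation `X ↦ ζ − 1` of `Σ_j Col β (j)` at the character `χ`**: with `G = Col β`, a ring map
`κ : 𝒪_F⟦X⟧ → S` with `κ(X) = ζ − 1` (`ζ^{p^m} = 1`), coefficients `ψ : 𝒪_{E_m} → S` with `κ ∘ C = ψ ∘ ι`, and `χ(φ_m) = ζ`:
**`C(Σ_σ χ(σ⁻¹)ψ(σθ_m)) · κ(Σ_j G_j) = Σ_{σ ∈ Gal(E_m/F)} C(χ(σ⁻¹)) · (ψ ∘ σ)(r_{β,m})`** in `S⟦Y⟧` (coefficient `k`: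
`κ(Σ_j [Y^k]G_j) = Σ_ρ χ(ρ)ψ(a(ρ))` by `IsTransformProd` + §2, and §3).  At `χ = 1`, `S = 𝒪_{E_m}`: `C_sum_mul_specialization_eq_sum_map`.
[cite: deShalit1987, Ch. I §3.1, §3.8 (16)–(17); Ch. III §1.3] -/
theorem C_sum_character_mul_map_sum_colemanImage_eq {β : ∀ m, RelNormCoherentUnits hπ (E m)}
    (hβ : ∀ m, (β (m + 1)).baseNorm hπ (hmono (Nat.le_succ m)) = β m) (m : ℕ) (ψ : unitBall (E m) →+* S)
    (κ : PowerSeries 𝒪[F] →+* S) (hκψ : ∀ a : 𝒪[F], κ (PowerSeries.C a) = ψ (algebraMap 𝒪[F] (unitBall (E m)) a))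
    (ζ : S) (hζ : ζ ^ p ^ m = 1) (hκX : κ PowerSeries.X = ζ - 1) (χ : (E m ≃ₐ[F] E m) →* S)
    (hχ : χ ((absoluteGaloisGroup.toAlgEquiv F σ₀).restrictNormal (E m)) = ζ) :
    PowerSeries.C (∑ σ : E m ≃ₐ[F] E m, χ σ⁻¹ * ψ (unitBallEquiv (E m) σ (θ m))) *
        PowerSeries.map κ (∑ j : ZMod d, TActModule.toPS (colemanImage hd hπ E hmono hE hdeg hσ₀ hq u hu γ hθ hcoh hβ j)) =
      ∑ σ : E m ≃ₐ[F] E m, PowerSeries.C (χ σ⁻¹) *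
        PowerSeries.map (ψ.comp (unitBallEquiv (E m) σ : unitBall (E m) →+* unitBall (E m)))
          (relUnitCoordTwo hπ (E m) hq (hE m) hσ₀ u hu (β m)) := by
  classical
  ext k
  have hT := isTransformProd_colemanImage hd hπ E hmono hE hdeg hσ₀ hq u hu γ hθ hcoh hβ m k
  have hc : κ (PowerSeries.coeff k (∑ j : ZMod d, TActModule.toPS (colemanImage hd hπ E hmono hE hdeg hσ₀ hq u hu γ hθ hcoh hβ j))) =
      ∑ σ : E m ≃ₐ[F] E m, χ σ * κ (PowerSeries.C
        ((hθ m).basis.repr (PowerSeries.coeff k (relUnitCoordTwo hπ (E m) hq (hE m) hσ₀ u hu (β m))) σ)) := by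
    rw [map_sum]
    exact map_sum_eq_sum_character_of_isAmiceLevel hd E hE hdeg hσ₀ hT κ ζ hζ hκX χ hχ
  rw [PowerSeries.coeff_C_mul, PowerSeries.coeff_map, hc, map_sum (PowerSeries.coeff k), mul_comm]
  simp_rw [PowerSeries.coeff_C_mul, PowerSeries.coeff_map, RingHom.comp_apply, RingHom.coe_coe, hκψ]
  rw [sum_character_mul_map_unitBallEquiv_eq (hθ m) ψ χ (PowerSeries.coeff k (relUnitCoordTwo hπ (E m) hq (hE m) hσ₀ u hu (β m)))]

/-! ### §5. `S = 𝒪_{E'}`: the moments of the `χ`-specialised trace are the `χ`-resolvents of the moments -/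

include hdeg hE hσ₀ in
/-- ★★★ **THE MOMENTS OF THE `χ`-SPECIALISED TRACE ARE THE `χ`-RESOLVENTS OF THE COATES–WILES MOMENTS**: for a finite subextension
`E' ⊇ E_m` of `F̄`, a ring map `κ : 𝒪_F⟦X⟧ → 𝒪_{E'}` over `𝒪_F` with `κ(X) = ζ − 1`, `ζ^{p^m} = 1`, and a character `χ : Gal(E_m/F) → 𝒪_{E'}` with
`χ(φ_m) = ζ`: **`(Σ_σ χ(σ⁻¹)σθ_m) · mom_k(κ(Σ_j Col β (j))) = Σ_{σ ∈ Gal(E_m/F)} χ(σ⁻¹) · σ(mom_k(r_{β,m}))`** in `𝒪_{E'}` — and `mom_k(r_{β,m})`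
is the `k`-th Coates–Wiles value of `β_m` (`coordMoment_relUnitCoordTwo_eq_coatesWiles`).  At `χ = 1`, `E' = E_m`, `κ = ι_m ∘ [X⁰]` this is
`sum_unitBallEquiv_mul_coordMoment_specialization`. [cite: deShalit1987, Ch. I §3.1, §3.5 (11), §3.8 (16)–(17); Ch. II §4.7 (15), §4.12 (31); Ch. III §1.3] -/
theorem sum_character_mul_coordMoment_specialization {β : ∀ m, RelNormCoherentUnits hπ (E m)}
    (hβ : ∀ m, (β (m + 1)).baseNorm hπ (hmono (Nat.le_succ m)) = β m) (m k : ℕ)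
    {E' : IntermediateField F (AlgebraicClosure F)} [FiniteDimensional F E'] (hE' : E m ≤ E')
    (κ : PowerSeries 𝒪[F] →+* unitBall E') (hκC : ∀ a : 𝒪[F], κ (PowerSeries.C a) = algebraMap 𝒪[F] (unitBall E') a)
    (ζ : unitBall E') (hζ : ζ ^ p ^ m = 1) (hκX : κ PowerSeries.X = ζ - 1) (χ : (E m ≃ₐ[F] E m) →* unitBall E')
    (hχ : χ ((absoluteGaloisGroup.toAlgEquiv F σ₀).restrictNormal (E m)) = ζ) :
    (∑ σ : E m ≃ₐ[F] E m, χ σ⁻¹ * inclUnitBall (F := F) hE' (unitBallEquiv (E m) σ (θ m))) *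
        coordMoment hπ E' u k (PowerSeries.map κ
          (∑ j : ZMod d, TActModule.toPS (colemanImage hd hπ E hmono hE hdeg hσ₀ hq u hu γ hθ hcoh hβ j))) =
      ∑ σ : E m ≃ₐ[F] E m, χ σ⁻¹ *
        inclUnitBall (F := F) hE' (unitBallEquiv (E m) σ (coordMoment hπ (E m) u k (relUnitCoordTwo hπ (E m) hq (hE m) hσ₀ u hu (β m)))) := by
  classical
  have hκψ : ∀ a : 𝒪[F], κ (PowerSeries.C a) =
      (inclUnitBall (F := F) hE' : unitBall (E m) →+* unitBall E') (algebraMap 𝒪[F] (unitBall (E m)) a) := fun a => by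
    rw [hκC, RingHom.coe_coe, inclUnitBall_algebraMap_pi hE']
  have h4 := C_sum_character_mul_map_sum_colemanImage_eq hd hπ E hmono hE hdeg hσ₀ hq u hu γ hθ hcoh hβ m _ κ hκψ ζ hζ hκX χ hχ
  simp only [RingHom.coe_coe] at h4
  rw [← coordMoment_C_mul hπ E' u, h4]
  have hψ : ∀ (σ : E m ≃ₐ[F] E m) (a : LTCoeff F),
      ((inclUnitBall (F := F) hE' : unitBall (E m) →+* unitBall E').comp (unitBallEquiv (E m) σ : unitBall (E m) →+* unitBall (E m)))
          (algebraMap (LTCoeff F) (unitBall (E m)) a) = algebraMap (LTCoeff F) (unitBall E') a := fun σ a => by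
    rw [RingHom.comp_apply, unitBallEquiv_algebraMap_LTCoeff, RingHom.coe_coe, AlgHom.commutes]
  have hsum : ∀ (s : Finset (E m ≃ₐ[F] E m)),
      coordMoment hπ E' u k (∑ σ ∈ s, PowerSeries.C (χ σ⁻¹) *
        PowerSeries.map (((inclUnitBall (F := F) hE' : unitBall (E m) →+* unitBall E')).comp
          (unitBallEquiv (E m) σ : unitBall (E m) →+* unitBall (E m))) (relUnitCoordTwo hπ (E m) hq (hE m) hσ₀ u hu (β m))) =
      ∑ σ ∈ s, χ σ⁻¹ *
        inclUnitBall (F := F) hE' (unitBallEquiv (E m) σ (coordMoment hπ (E m) u k (relUnitCoordTwo hπ (E m) hq (hE m) hσ₀ u hu (β m)))) := by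
    intro s
    induction s using Finset.induction_on with
    | empty => rw [sum_empty, sum_empty, coordMoment_zero]
    | insert σ s hσ ih =>
      rw [sum_insert hσ, sum_insert hσ, coordMoment_add, ih, coordMoment_C_mul, coordMoment_map_of_forall_eq hπ u _ (hψ σ) k]
      simp only [RingHom.comp_apply, RingHom.coe_coe]
  exact hsum univ

include hdeg hE hσ₀ in
/-- Unit test (`χ = 1`, `E' = E_m`, `ζ = 1`, `κ = ι_m ∘ [X⁰]`): `sum_character_mul_coordMoment_specialization` specialises VERBATIM to
`sum_unitBallEquiv_mul_coordMoment_specialization`. [cite: deShalit1987, Ch. I §3.5 (11), §3.8 (16)–(17)] -/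
example {β : ∀ m, RelNormCoherentUnits hπ (E m)} (hβ : ∀ m, (β (m + 1)).baseNorm hπ (hmono (Nat.le_succ m)) = β m) (m k : ℕ) :
    (∑ σ : E m ≃ₐ[F] E m, unitBallEquiv (E m) σ (θ m)) *
        coordMoment hπ (E m) u k (PowerSeries.map (algebraMap 𝒪[F] (unitBall (E m))) (PowerSeries.map (PowerSeries.constantCoeff (R := 𝒪[F]))
          (∑ j : ZMod d, TActModule.toPS (colemanImage hd hπ E hmono hE hdeg hσ₀ hq u hu γ hθ hcoh hβ j)))) =
      ∑ σ : E m ≃ₐ[F] E m, unitBallEquiv (E m) σ (coordMoment hπ (E m) u k (relUnitCoordTwo hπ (E m) hq (hE m) hσ₀ u hu (β m))) := by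
  classical
  have h := sum_character_mul_coordMoment_specialization hd hπ E hmono hE hdeg hσ₀ hq u hu γ hθ hcoh hβ m k (le_refl (E m))
    ((algebraMap 𝒪[F] (unitBall (E m))).comp (PowerSeries.constantCoeff (R := 𝒪[F])))
    (fun a => by rw [RingHom.comp_apply, PowerSeries.constantCoeff_C]) 1 (one_pow _)
    (by rw [RingHom.comp_apply, PowerSeries.constantCoeff_X, map_zero, sub_self]) 1 (MonoidHom.one_apply _)
  have hincl : ∀ z : unitBall (E m), inclUnitBall (F := F) (le_refl (E m)) z = z := fun z => Subtype.ext rfl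
  simp only [MonoidHom.one_apply, one_mul, hincl, PowerSeries.map_comp, RingHom.comp_apply] at h
  exact h

end UnitsImageSpecializationCharacterTwo

end Literature.NumberTheory.GaloisRepresentations
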